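import Mathlib
import Literature.Analysis.ODE.InverseSquareLadderExpansion
import Literature.Analysis.Calculus.EnergyTailCutoff
import HarnessLib

/-!
# Tools for the smooth-approximation step of the exact ladder isometry

Analysis/ODE support file (everything proved, no definitions): (i) the ladder `ladder ι n u` on
`(½, ∞)` is bounded by the sup norms of `u, u′, …, u⁽ⁿ⁾` (`exists_abs_ladder_le`, from the expansion
`ladder ι n u = Σ β_j ι^{n−j} u⁽ʲ⁾` of `InverseSquareLadderExpansion.lean` and `ι = x⁻¹ ≤ 2` there);
(ii) `|∫_a^b u² − ∫_a^b v²| ≤ (b−a) δ (2M + δ)` for `|u − v| ≤ δ`, `|v| ≤ M`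
(`abs_integral_sq_sub_sq_le`); (iii) the bookkeeping `κη(2M+κη) ≤ ηκ(2M+κ)` for `η ≤ 1` and
"`|A − B| ≤ ηC` for all `η ∈ (0,1]` forces `A = B`"; (iv) a smooth cutoff equal to `1` on `(−∞, R₁]`
and to `0` on `[B+1, ∞)` (`exists_cutoff_Iic_Ici`, from `EnergyTailCutoff.exists_smooth_cutoff`).
Used by `LadderIsometryDensity.lean` to lower the regularity of the exact ladder isometry to the
natural one (route PhotonSphereChannels, `WindowedShellChannels`, stmt-FinalStateConjecture-14085).
Folklore.
-/

noncomputable section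

namespace Literature.Analysis.ODE

open Set Filter Topology Finset Real MeasureTheory Literature.Analysis.Calculus

variable {ι : ℝ → ℝ}

/-! ### The ladder is controlled by the derivatives of order `≤ n` on `(½, ∞)` -/

/-- **Sup bound for the ladder.** For a smooth `ι = x⁻¹` on `[½,∞)` there is `Λ = Λ(n, ι) ≥ 0` with
`|ladder ι n u (x)| ≤ Λ δ` for `x > ½` whenever `|u⁽ʲ⁾| ≤ δ` on `ℝ` for all `j ≤ n` (`u ∈ Cⁿ`).
[folklore] -/
theorem exists_abs_ladder_le (hι : ContDiff ℝ (⊤ : ℕ∞) ι)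
    (hιeq : ∀ x : ℝ, 1 / 2 ≤ x → ι x = x⁻¹) (n : ℕ) :
    ∃ Λ : ℝ, 0 ≤ Λ ∧ ∀ (u : ℝ → ℝ), ContDiff ℝ n u → ∀ δ : ℝ,
      (∀ j, j ≤ n → ∀ x, |iteratedDeriv j u x| ≤ δ) → ∀ x, 1 / 2 < x → |ladder ι n u x| ≤ Λ * δ := by
  have hric : ∀ x ∈ Ioi (1 / 2 : ℝ), deriv ι x = -(ι x) ^ 2 := by
    intro x hx
    have hx' : (1 / 2 : ℝ) < x := hx
    have hev : ι =ᶠ[𝓝 x] fun y => y⁻¹ :=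
      Filter.mem_of_superset (Ioi_mem_nhds hx') fun y hy => hιeq y (le_of_lt hy)
    rw [hev.deriv_eq, deriv_inv, hιeq x hx'.le]; field_simp
  obtain ⟨β, -, hexp⟩ := exists_ladder_expansion hι isOpen_Ioi hric n
  refine ⟨∑ j ∈ range (n + 1), |β j| * 2 ^ (n - j), Finset.sum_nonneg fun j _ => by positivity, ?_⟩
  intro u hu δ hδ x hx
  have hδ0 : 0 ≤ δ := (abs_nonneg _).trans (hδ 0 (Nat.zero_le _) x)
  have hιx : |ι x| ≤ 2 := by
    rw [hιeq x hx.le, abs_of_pos (inv_pos.2 (by linarith))]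
    rw [inv_le_comm₀ (by linarith) (by norm_num)]
    linarith
  rw [hexp u hu x hx, Finset.sum_mul]
  refine (Finset.abs_sum_le_sum_abs _ _).trans (Finset.sum_le_sum fun j hj => ?_)
  have hjn : j ≤ n := Nat.lt_succ_iff.1 (mem_range.1 hj)
  rw [abs_mul, abs_mul, abs_pow]
  have h1 : |ι x| ^ (n - j) ≤ 2 ^ (n - j) := pow_le_pow_left₀ (abs_nonneg _) hιx _
  calc |β j| * |ι x| ^ (n - j) * |iteratedDeriv j u x|
      ≤ |β j| * 2 ^ (n - j) * δ :=
        mul_le_mul (mul_le_mul_of_nonneg_left h1 (abs_nonneg _)) (hδ j hjn x) (abs_nonneg _)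
          (by positivity)
    _ = |β j| * 2 ^ (n - j) * δ := rfl

/-! ### Elementary estimates for differences of integrals of squares -/

/-- `|∫_a^b u² − ∫_a^b v²| ≤ (b − a) δ (2M + δ)` if `|u − v| ≤ δ` and `|v| ≤ M` on `[a, b]`. [folklore] -/
theorem abs_integral_sq_sub_sq_le {u v : ℝ → ℝ} (hu : Continuous u) (hv : Continuous v) {a b δ M : ℝ}
    (hab : a ≤ b) (hδ : 0 ≤ δ) (huv : ∀ x ∈ Icc a b, |u x - v x| ≤ δ) (hM : ∀ x ∈ Icc a b, |v x| ≤ M) :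
    |(∫ x in a..b, u x ^ 2) - ∫ x in a..b, v x ^ 2| ≤ (b - a) * (δ * (2 * M + δ)) := by
  have hM0 : 0 ≤ M := (abs_nonneg _).trans (hM a ⟨le_rfl, hab⟩)
  have iu : IntervalIntegrable (fun x => u x ^ 2) volume a b := (hu.pow 2).intervalIntegrable _ _
  have iv : IntervalIntegrable (fun x => v x ^ 2) volume a b := (hv.pow 2).intervalIntegrable _ _
  rw [← intervalIntegral.integral_sub iu iv]
  have hbound : ∀ x ∈ uIoc a b, ‖u x ^ 2 - v x ^ 2‖ ≤ δ * (2 * M + δ) := by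
    intro x hx
    rw [uIoc_of_le hab] at hx
    have hx' : x ∈ Icc a b := ⟨hx.1.le, hx.2⟩
    have h1 := huv x hx'
    have h2 := hM x hx'
    rw [Real.norm_eq_abs, show u x ^ 2 - v x ^ 2 = (u x - v x) * ((u x - v x) + 2 * v x) by ring,
      abs_mul]
    have h3 : |u x - v x + 2 * v x| ≤ δ + 2 * M := by
      calc |u x - v x + 2 * v x| ≤ |u x - v x| + |2 * v x| := abs_add_le _ _
        _ ≤ δ + 2 * M := by rw [abs_mul, abs_two]; linarith
    calc |u x - v x| * |u x - v x + 2 * v x| ≤ δ * (δ + 2 * M) :=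
          mul_le_mul h1 h3 (abs_nonneg _) hδ
      _ = δ * (2 * M + δ) := by ring
  have := intervalIntegral.norm_integral_le_of_norm_le_const hbound
  rw [Real.norm_eq_abs, abs_of_nonneg (by linarith : (0:ℝ) ≤ b - a)] at this
  linarith [this]

/-- `κη(2M + κη) ≤ η·κ(2M + κ)` for `0 ≤ κ` and `0 < η ≤ 1`. [folklore] -/
theorem mul_eta_bound {κ M η : ℝ} (hκ : 0 ≤ κ) (hη : 0 < η) (hη1 : η ≤ 1) :
    κ * η * (2 * M + κ * η) ≤ η * (κ * (2 * M + κ)) := by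
  have h1 : κ * η ≤ κ := mul_le_of_le_one_right hκ hη1
  have h2 : 0 ≤ κ * η := by positivity
  calc κ * η * (2 * M + κ * η) ≤ κ * η * (2 * M + κ) := mul_le_mul_of_nonneg_left (by linarith) h2
    _ = η * (κ * (2 * M + κ)) := by ring

/-- If `|A − B| ≤ η C` for every `η ∈ (0, 1]` then `A = B`. [folklore] -/
theorem eq_of_forall_abs_sub_le_mul {A B C : ℝ} (hC : 0 ≤ C)
    (h : ∀ η : ℝ, 0 < η → η ≤ 1 → |A - B| ≤ η * C) : A = B := by
  by_contra hne
  set d : ℝ := |A - B| with hd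
  have hdpos : 0 < d := abs_pos.2 (sub_ne_zero.2 hne)
  set η : ℝ := min 1 (d / (2 * (C + 1))) with hη
  have hηpos : 0 < η := by rw [hη]; positivity
  have hη1 : η ≤ 1 := min_le_left _ _
  have hηd : η ≤ d / (2 * (C + 1)) := min_le_right _ _
  have hm := h η hηpos hη1
  have hD1 : η * (2 * (C + 1)) ≤ d := (le_div_iff₀ (by positivity)).1 hηd
  have hηC : 0 ≤ η * C := mul_nonneg hηpos.le hC
  have hlt : η * C < d := by nlinarith
  linarith

/-! ### The isometries at the natural regularity -/

/-- Common approximation step: a smooth cutoff `χ` with `χ = 1` on `(−∞, R₁]` and `χ = 0` on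
`[B+1, ∞)`. [folklore] -/
theorem exists_cutoff_Iic_Ici {R₁ B : ℝ} (h : R₁ < B + 1) :
    ∃ χ : ℝ → ℝ, ContDiff ℝ (⊤ : ℕ∞) χ ∧ (∀ x, x ≤ R₁ → χ x = 1) ∧ (∀ x, B + 1 ≤ x → χ x = 0) := by
  obtain ⟨χ₀, hC, h1, h0, -, -⟩ := exists_smooth_cutoff
  refine ⟨fun x => χ₀ (1 + (x - R₁) / (B + 1 - R₁)), ?_, ?_, ?_⟩
  · exact hC.comp (contDiff_const.add ((contDiff_id.sub contDiff_const).div_const _))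
  · intro x hx
    refine h1 _ ?_
    have : (x - R₁) / (B + 1 - R₁) ≤ 0 := div_nonpos_of_nonpos_of_nonneg (by linarith) (by linarith)
    linarith
  · intro x hx
    refine h0 _ ?_
    have : 1 ≤ (x - R₁) / (B + 1 - R₁) := by rw [le_div_iff₀ (by linarith)]; linarith
    linarith

end Literature.Analysis.ODE
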